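import Summits.BirchSwinnertonDyer.BirchSwinnertonDyer.Theorems.GenusKolyvaginAtTwoGenusDeepSupplyAtTwoNegDiscNarrowDepthZeroAntiInvariantRational
import Summits.BirchSwinnertonDyer.BirchSwinnertonDyer.Theorems.GenusKolyvaginAtTwoShaCardDvdPowAtTwoPosTOnCutRankQ
import HarnessLib

/-!
# Route `GenusKolyvaginAtTwo`, crux `GenusDeepSupplyAtTwoNegDiscNarrow` (stmt-BirchSwinnertonDyer-23491): CLAIM B FOR COMPOSITE
# HEEGNER FIELDS, I — the narrow twin's Tamagawa clause `ord₂ c(Wd) ≤ 1` SILENCES every prime of `d_K` but one, and Claim B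
# (twisted / curve / `K`-rational forms) holds at the remaining prime

Width seat `bsd-line-gk2-p4` g26 (cell `bsd-f1-sign2`), `--supports stmt-BirchSwinnertonDyer-23491` (helper; closes nothing).
THEOREMS ONLY (no definition, no named fact, no `sorry`); **BSD is NOT proved by any of this; no item is closed.**

CONTEXT.  The LEAD's depth-zero reduction criterion (memo `DEPTH-ZERO-REDUCTION-CRITERION-g21.md`) turns the kernel K₁ of the
registered stub C‴ on the `#Sel₂(E) = 1` cell into ONE REDUCTION BIT R₁ (`DepthZero.K1_of_reductionBit`, p762289: R₁ ⟹ K₁, with R₁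
quantified over EVERY (H2)-admissible Heegner field `K`).  The converse K₁ ⟹ R₁ («Claim B») was landed by g25 for the PRIME Heegner
fields `d_K = −ℓ` only (`reductionBit_of_not_two_dvd_derivedPoint_prime`, p764750), where the silence hypothesis of the global half
`twin_selmer_eq_zero_of_localization_eq_zero_of_selmerTrivial` (p763963 §2: every prime of `d_K` off the distinguished place `v₀`
has `#W(ℚ_v)[2] = #Wd(ℚ_v)[2] = 1`) is vacuous.  This file removes the primality restriction:

* §1 `exists_prime_dvd_discr_forall_ne_twoTorsion_padic_eq_zero` — `W/ℚ` globally minimal with `C(W)` odd, `K` imaginary quadratic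
  with odd `d_K`, Heegner for `N_W`, `Wd = Cd • W^{(d_K)}` elliptic with **`ord₂ C(Wd) ≤ 1`** ⟹ there is a prime `ℓ ∣ d_K` such that
  **every OTHER prime `q ∣ d_K` is silent** (`W(ℚ_q)[2] = 0`): `ord₂ C(Wd) = ord₂ C(W) + Σ_{q ∣ d_K} ord₂(1 + #roots_q(ψ))` (gk2-p3
  `padicValNat_two_tamagawaProduct_twin_eq`) with `1 + #roots_q` a power of `2`, so a budget `≤ 1` leaves at most one summand;
  `silent_off_of_forall_ne_twoTorsion_padic_eq_zero` — the same in the `hsil` currency of p763963 §2 for ANY model of the twin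
  (`#Wd'(ℚ_v)[2] = #W(ℚ_v)[2]` through the master intertwining `Wd'[2] ≅ W[2]`).
* §2 Claim B with a silence hypothesis off `v₀ ∋ ℓ`, `ℓ ∣ d_K` any prime (verbatim g25's p764388 §3 / p764523 §3 / p764719 §2 with
  `discr K = -ℓ` replaced by `(ℓ:ℤ) ∣ discr K` + `hsil`): `geomReduction_twist_ne_zero_of_kummer_ne_zero_of_selmerTrivial_of_silent`
  (`κ(z) ≠ 0 ⟹ red_𝔓(F z̃) ≠ Õ`), `geomReduction_map_absEmbedding_ne_zero_of_anti_of_noHalf_of_silent` and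
  `geomReduction_map_absEmbedding_ne_zero_of_anti_of_not_two_dvd_of_silent` (`Y ∈ E(K)⁻ ∖ 2E(K) ⟹ red_𝔓(e_*Y) ≠ Õ`).

The sequel `…DepthZeroReductionBitOfK1Composite` assembles K₁ ⟹ R₁ on the whole cell and the equivalence K₁ ⟺ R₁ as typed.

References: [MazurRubin2010] Lemma 2.2 (i), Prop. 3.3, Cor. 3.4 (i); [Kramer1981] §2 Prop. 3; [SilvermanAEC2009] VII.3.1 (b),
X.5 Cor. 5.4, VIII §1–§2; [BoxerDiao2010] proof of Prop. 4.1; [GrossLMS1991] §1, §5 Prop. 5.3.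
-/

set_option linter.dupNamespace false -- tree convention: `Summit.BirchSwinnertonDyer.BirchSwinnertonDyer.Theorems` (summit = sub-problem)
set_option autoImplicit false

noncomputable section

open scoped Classical Pointwise

namespace Summit.BirchSwinnertonDyer.BirchSwinnertonDyer.Theorems.GenusSupplyNarrow.DepthZero

open WeierstrassCurve Field NumberField IsDedekindDomain Function
open Literature.NumberTheory.EllipticCurves Literature.NumberTheory.GaloisRepresentations
open Literature.NumberTheory.GaloisCohomology
open Rat.HeightOneSpectrum (primesEquiv natGenerator)
open Summit.BirchSwinnertonDyer.BirchSwinnertonDyer.Theorems.GenusKolyArch (hdiv_two natCard_ker_nsmul_eq_of_intertwining)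
open Summit.BirchSwinnertonDyer.BirchSwinnertonDyer.Theorems.GenusKolyTwistingPrime (primesEquiv_eq)
open Summit.BirchSwinnertonDyer.BirchSwinnertonDyer.Theorems.GenusKolyTwistLocal (natCard_ker_nsmul_adicCompletion_eq_padic
  exists_intertwining_master_frame)
open Summit.BirchSwinnertonDyer.BirchSwinnertonDyer.Theorems.GenusExact.PlusDescent (padicValNat_two_tamagawaProduct_twin_eq
  one_add_card_roots_eq_two_pow not_dvd_minimalDiscriminantInt_of_dvd_discr_of_heegner)

/-! ## §1 `ord₂ C(Wd) ≤ 1`: every prime of `d_K` but one is silent -/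

section Silent

variable (W : WeierstrassCurve ℚ) [W.IsElliptic] [W.IsGloballyMinimal] {K : Type} [Field K] [NumberField K]

/-- **A vanishing root valuation silences the prime.**  `W/ℚ` globally minimal, `K` quadratic with odd `d_K` and the Heegner
hypothesis for `N_W`, `q ∣ d_K` a prime with `ord₂(#roots_q(ψ) + 1) = 0` (`ψ = 4x³ + b₂x² + 2b₄x + b₆` the `2`-division cubic of the
integral minimal model): then `W(ℚ_q)[2] = 0` (`q` is odd and good, `#W(ℚ_q)[2] = 1 + #roots_q` is a power of `2`).
[cite: Kramer1981, §2 Prop. 3 (p. 125)] [cite: MazurRubin2010, Lemma 2.2 (i)] [cite: SilvermanAEC2009, VII.3 Prop. 3.1 (b)] -/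
theorem twoTorsion_padic_eq_zero_of_padicValNat_roots_eq_zero (h2 : Module.finrank ℚ K = 2) (hodd : Odd (discr K))
    (hH : SatisfiesHeegnerHypothesis (W.conductorNorm ℤ) K) {q : ℕ} [Fact q.Prime] (hqd : (q : ℤ) ∣ discr K)
    (hf : padicValNat 2 ({x : ZMod q | 4 * x ^ 3 + ((integralModelInt W).b₂ : ZMod q) * x ^ 2 +
      2 * ((integralModelInt W).b₄ : ZMod q) * x + ((integralModelInt W).b₆ : ZMod q) = 0}.ncard + 1) = 0) :
    ∀ Q : (W.baseChange ℚ_[q]).toAffine.Point, 2 • Q = 0 → Q = 0 := by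
  have hqP : q.Prime := Fact.out
  have hq2 : q ≠ 2 := by
    rintro rfl
    obtain ⟨r, hr⟩ := hodd
    omega
  have hqΔ : ¬ (q : ℤ) ∣ minimalDiscriminantInt W := not_dvd_minimalDiscriminantInt_of_dvd_discr_of_heegner W K h2 hH hqP hq2 hqd
  -- `1 + #roots_q = 2^(f q) = 1`
  have hroots := one_add_card_roots_eq_two_pow W hq2 hqΔ
  have hncard : ({x : ZMod q | 4 * x ^ 3 + ((integralModelInt W).b₂ : ZMod q) * x ^ 2 +
      2 * ((integralModelInt W).b₄ : ZMod q) * x + ((integralModelInt W).b₆ : ZMod q) = 0} : Set (ZMod q)).ncard =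
      (Finset.univ.filter fun x : ZMod q =>
        4 * x ^ 3 + ((integralModelInt W).b₂ : ZMod q) * x ^ 2 +
          2 * ((integralModelInt W).b₄ : ZMod q) * x + ((integralModelInt W).b₆ : ZMod q) = 0).card := by
    rw [← Set.ncard_coe_finset]
    congr 1
    ext x
    simp
  have hfp' : padicValNat 2 (1 + (Finset.univ.filter fun x : ZMod q =>
        4 * x ^ 3 + ((integralModelInt W).b₂ : ZMod q) * x ^ 2 +
          2 * ((integralModelInt W).b₄ : ZMod q) * x + ((integralModelInt W).b₆ : ZMod q) = 0).card) = 0 := by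
    rw [hncard, add_comm] at hf
    exact hf
  rw [hfp', pow_zero] at hroots
  have hcard : (Finset.univ.filter fun x : ZMod q =>
      4 * x ^ 3 + ((integralModelInt W).b₂ : ZMod q) * x ^ 2 +
        2 * ((integralModelInt W).b₄ : ZMod q) * x + ((integralModelInt W).b₆ : ZMod q) = 0).card = 0 := by omega
  refine GenusKolyTwin.twoTorsion_padic_eq_zero_of_forall_ne W hq2 hqΔ (fun x hx ↦ ?_)
  have hmem : x ∈ (Finset.univ.filter fun x : ZMod q =>
      4 * x ^ 3 + ((integralModelInt W).b₂ : ZMod q) * x ^ 2 +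
        2 * ((integralModelInt W).b₄ : ZMod q) * x + ((integralModelInt W).b₆ : ZMod q) = 0) :=
    Finset.mem_filter.mpr ⟨Finset.mem_univ x, hx⟩
  rw [Finset.card_eq_zero.mp hcard] at hmem
  exact Finset.notMem_empty x hmem

/-- **`ord₂ C(Wd) ≤ 1` ⟹ every prime of `d_K` but (at most) ONE is silent.**  `W/ℚ` globally minimal with `C(W)` odd, `K` imaginary
quadratic with odd `d_K` and the Heegner hypothesis for `N_W`, `Wd = Cd • W^{(d_K)}` elliptic with `ord₂ C(Wd) ≤ 1`: there is a
prime `ℓ ∣ d_K` such that `W(ℚ_q)[2] = 0` at every prime `q ∣ d_K`, `q ≠ ℓ`.  (`ord₂ C(Wd) = Σ_{q ∣ d_K} ord₂(1 + #roots_q)`, so at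
most one summand is positive; if none is, `ℓ` is any prime of `d_K`, which exists as `d_K ≡ 1 (4)`, `d_K < 0`.)  On `Δ_W < 0` the
exceptional prime is the transposition prime of `d_K` (`GenusKolyTwin.even_tamagawaProduct_twin_of_Δ_neg`), not needed here.
[cite: Kramer1981, §2 Prop. 3] [cite: BoxerDiao2010, proof of Prop. 4.1 (p. 1977)] [cite: MazurRubin2010, Lemma 2.2 (i)] -/
theorem exists_prime_dvd_discr_forall_ne_twoTorsion_padic_eq_zero (hK : IsImaginaryQuadratic K) (hodd : Odd (discr K))
    (hH : SatisfiesHeegnerHypothesis (W.conductorNorm ℤ) K) (hTam : Odd W.tamagawaProduct)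
    {Wd : WeierstrassCurve ℚ} [Wd.IsElliptic] (Cd : VariableChange ℚ) (hWd : Cd • W.quadraticTwist (discr K : ℚ) = Wd)
    (hB : padicValNat 2 Wd.tamagawaProduct ≤ 1) :
    ∃ ℓ : ℕ, ℓ.Prime ∧ (ℓ : ℤ) ∣ discr K ∧
      ∀ (q : ℕ) [Fact q.Prime], (q : ℤ) ∣ discr K → q ≠ ℓ → ∀ Q : (W.baseChange ℚ_[q]).toAffine.Point, 2 • Q = 0 → Q = 0 := by
  haveI : Fact (Nat.Prime 2) := ⟨Nat.prime_two⟩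
  set S := (discr K).natAbs.primeFactors with hS
  set f : ℕ → ℕ := fun q ↦ padicValNat 2
    ({x : ZMod q | 4 * x ^ 3 + ((integralModelInt W).b₂ : ZMod q) * x ^ 2 +
      2 * ((integralModelInt W).b₄ : ZMod q) * x + ((integralModelInt W).b₆ : ZMod q) = 0}.ncard + 1) with hf
  have hW0 : padicValNat 2 W.tamagawaProduct = 0 :=
    padicValNat.eq_zero_of_not_dvd fun h ↦ (Nat.not_even_iff_odd.mpr hTam) (even_iff_two_dvd.mpr h)
  have hsum : ∑ q ∈ S, f q ≤ 1 := by
    have h := padicValNat_two_tamagawaProduct_twin_eq W hK hodd hH Cd hWd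
    rw [hW0, zero_add] at h
    rw [← h]
    exact hB
  have hd0 : (discr K).natAbs ≠ 0 := Int.natAbs_ne_zero.mpr (discr_ne_zero K)
  have hmemS : ∀ {q : ℕ}, q.Prime → (q : ℤ) ∣ discr K → q ∈ S := fun {q} hqP hqd ↦ by
    rw [hS, Nat.mem_primeFactors]
    exact ⟨hqP, Int.natCast_dvd.mp (by simpa using hqd), hd0⟩
  -- `S` is non-empty: `d_K ≡ 1 (mod 4)` and `d_K < 0` give `|d_K| > 1`
  have hSne : S.Nonempty := by
    rw [hS, Nat.nonempty_primeFactors]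
    have h4 : discr K % 4 = 1 := Literature.NumberTheory.QuadraticFields.Quadratic.discr_emod_four_eq_one hK.1 hodd
    have hneg : discr K < 0 := IsImaginaryQuadratic.discr_neg hK
    omega
  by_cases hex : ∃ ℓ ∈ S, f ℓ ≠ 0
  · obtain ⟨ℓ, hℓS, hℓ⟩ := hex
    have hℓP : ℓ.Prime := Nat.prime_of_mem_primeFactors hℓS
    refine ⟨ℓ, hℓP, Int.natCast_dvd.mpr (Nat.dvd_of_mem_primeFactors hℓS), fun q _ hqd hqℓ ↦ ?_⟩
    have hqS : q ∈ S := hmemS Fact.out hqd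
    have hle : f q + f ℓ ≤ 1 := by
      have hsub : ({q, ℓ} : Finset ℕ) ⊆ S := by
        intro x hx
        rcases Finset.mem_insert.mp hx with rfl | hx
        · exact hqS
        · rwa [Finset.mem_singleton.mp hx]
      have h := Finset.sum_le_sum_of_subset (f := f) hsub
      rw [Finset.sum_pair hqℓ] at h
      exact h.trans hsum
    have hfq : f q = 0 := by omega
    exact twoTorsion_padic_eq_zero_of_padicValNat_roots_eq_zero W hK.1 hodd hH hqd hfq
  · push Not at hex
    obtain ⟨ℓ, hℓS⟩ := hSne
    refine ⟨ℓ, Nat.prime_of_mem_primeFactors hℓS, Int.natCast_dvd.mpr (Nat.dvd_of_mem_primeFactors hℓS),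
      fun q _ hqd _ ↦ ?_⟩
    exact twoTorsion_padic_eq_zero_of_padicValNat_roots_eq_zero W hK.1 hodd hH hqd (hex q (hmemS Fact.out hqd))

omit [W.IsGloballyMinimal] in
/-- **Silence in the `hsil` currency of the global half, for ANY model of the twin.**  If `W(ℚ_q)[2] = 0` at every prime `q ∣ d_K`
other than `ℓ`, `v₀ ∋ ℓ`, and `Wd' = C • W^{(d_K)}` is any elliptic model, then every finite place `v ≠ v₀` over a prime of `d_K` has
`#W(ℚ_v)[2] = #Wd'(ℚ_v)[2] = 1` (`#Wd'(ℚ_v)[2] = #W(ℚ_v)[2]` through the `Γ_ℚ`-intertwining `Wd'[2] ≅ W[2]` of the master frame).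
[cite: MazurRubin2010, Lemma 2.2 (i)–(ii)] [cite: SilvermanAEC2009, X.5 Cor. 5.4] -/
theorem silent_off_of_forall_ne_twoTorsion_padic_eq_zero (hd0 : (discr K : ℚ) ≠ 0) {ℓ : ℕ} (hℓ : ℓ.Prime)
    (hsilQ : ∀ (q : ℕ) [Fact q.Prime], (q : ℤ) ∣ discr K → q ≠ ℓ →
      ∀ Q : (W.baseChange ℚ_[q]).toAffine.Point, 2 • Q = 0 → Q = 0)
    {v₀ : HeightOneSpectrum (𝓞 ℚ)} (hv₀ : (ℓ : 𝓞 ℚ) ∈ v₀.asIdeal)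
    {Wd : WeierstrassCurve ℚ} [Wd.IsElliptic] {C : VariableChange ℚ} (hC : C • W.quadraticTwist (discr K : ℚ) = Wd) :
    ∀ v : HeightOneSpectrum (𝓞 ℚ), v ≠ v₀ → (((primesEquiv v : Nat.Primes) : ℕ) : ℤ) ∣ discr K →
      Nat.card (nsmulAddMonoidHom 2 : (W.baseChange (v.adicCompletion ℚ)).toAffine.Point →+ _).ker = 1 ∧
      Nat.card (nsmulAddMonoidHom 2 : (Wd.baseChange (v.adicCompletion ℚ)).toAffine.Point →+ _).ker = 1 := by
  obtain ⟨φ, ψ, hψφ, hφψ, -⟩ := exists_intertwining_master_frame W Wd hd0 hC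
  intro v hv hvd
  haveI := Fact.mk (primesEquiv v).2
  have hne : ((primesEquiv v : Nat.Primes) : ℕ) ≠ ℓ := by
    intro h
    apply hv
    have hp₀ : ((primesEquiv v₀ : Nat.Primes) : ℕ) = ℓ := primesEquiv_eq hℓ hv₀
    exact primesEquiv.injective (Subtype.ext (h.trans hp₀.symm))
  have hker : Nat.card (nsmulAddMonoidHom 2 : (W.baseChange (v.adicCompletion ℚ)).toAffine.Point →+ _).ker = 1 := by
    rw [natCard_ker_nsmul_adicCompletion_eq_padic W v 2]
    have h0 := hsilQ ((primesEquiv v : Nat.Primes) : ℕ) hvd hne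
    rw [Nat.card_eq_one_iff_unique]
    exact ⟨⟨fun a b ↦ Subtype.ext ((h0 a.1 a.2).trans (h0 b.1 b.2).symm)⟩, ⟨⟨0, by simp⟩⟩⟩
  refine ⟨hker, ?_⟩
  -- the `CharZero` / `Algebra` instances are passed explicitly so that the `ℚ`-algebra structure of `ℚ_v` stays the `adicCompletion` one
  rw [@natCard_ker_nsmul_eq_of_intertwining ℚ _ _ W Wd _ _ 2 two_ne_zero φ ψ hψφ hφψ (v.adicCompletion ℚ) _
    (HeightOneSpectrum.instAlgebraAdicCompletion (𝓞 ℚ) ℚ v) (Literature.NumberTheory.GaloisRepresentations.charZero_adicCompletion v)]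
  exact hker

end Silent

/-! ## §2 Claim B at a prime `ℓ ∣ d_K` with silence off `ℓ` -/

section ClaimB

variable (W : WeierstrassCurve ℚ) [W.IsElliptic] [W.IsGloballyMinimal] {K : Type} [Field K] [NumberField K]

/-- **CLAIM B, TWISTED GEOMETRIC FORM, at any prime `ℓ ∣ d_K` with silence off `ℓ`.**  `W/ℚ` globally minimal elliptic with
`Δ_W < 0`, `K` quadratic with odd `d_K`, Heegner for `N_W`, `ℓ ∣ d_K` an odd prime with `ℓ ∤ Δ_min(W)`, `v₀ ∋ ℓ`, `Wd` an elliptic model of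
`W^{(d_K)}` with every prime of `d_K` off `v₀` silent for `W` and `Wd`, `F : Wd(ℚ̄) ≃+ W(ℚ̄)` signed, `#Sel₂(W) = 1`.  For `z ∈ Wd(ℚ)`
with `κ(z) ≠ 0`: **`red_𝔓(F z̃) ≠ Õ`** at the place over `ℓ` (g25's `…_prime` with the silence supplied as a hypothesis).
[cite: MazurRubin2010, Prop. 3.3, Cor. 3.4 (i)] [cite: SilvermanAEC2009, X.5 Cor. 5.4, VIII §2, VII.3.1] -/
theorem geomReduction_twist_ne_zero_of_kummer_ne_zero_of_selmerTrivial_of_silent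
    (hΔneg : W.Δ < 0) (h2 : Module.finrank ℚ K = 2) (hodd : Odd (discr K))
    (hH : SatisfiesHeegnerHypothesis (W.conductorNorm ℤ) K) {ℓ : ℕ} [Fact ℓ.Prime] (hℓ2 : ℓ ≠ 2)
    {v₀ : HeightOneSpectrum (𝓞 ℚ)} (hv₀ : (ℓ : 𝓞 ℚ) ∈ v₀.asIdeal)
    {Wd : WeierstrassCurve ℚ} [Wd.IsElliptic] {C : VariableChange ℚ} (hC : C • W.quadraticTwist (discr K : ℚ) = Wd)
    (hsil : ∀ v : HeightOneSpectrum (𝓞 ℚ), v ≠ v₀ → (((primesEquiv v : Nat.Primes) : ℕ) : ℤ) ∣ discr K →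
      Nat.card (nsmulAddMonoidHom 2 : (W.baseChange (v.adicCompletion ℚ)).toAffine.Point →+ _).ker = 1 ∧
      Nat.card (nsmulAddMonoidHom 2 : (Wd.baseChange (v.adicCompletion ℚ)).toAffine.Point →+ _).ker = 1)
    (F : Wd.geomPoints ≃+ W.geomPoints)
    (hF : ∀ σ : absoluteGaloisGroup ℚ, (∀ P, F (σ • P) = σ • F P) ∨ (∀ P, F (σ • P) = -(σ • F P)))
    (h1 : Nat.card (W.selmerGroup 2) = 1)
    (z : Wd.toAffine.Point) (hκ : kummerMapTorsion Wd ((2 : ℕ) : ℤ) (hdiv_two Wd) z ≠ 0)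
    (hΔ : ¬ (ℓ : ℤ) ∣ minimalDiscriminantInt W) :
    geomReduction hΔ (F (toGeomPoints Wd z)) ≠ 0 := by
  have hℓ : ℓ.Prime := Fact.out
  have hv₀' : ((primesEquiv v₀ : Nat.Primes) : ℕ) = ℓ := primesEquiv_eq hℓ hv₀
  -- the Kummer class of `z` is a non-zero Selmer class, hence non-strict at `v₀` (global half)
  have hκS : kummerMapTorsion Wd _ (hdiv_two Wd) z ∈ (Wd.kummerSelmerStructure ((2 : ℕ) : ℤ)).selmerGroup :=
    (SetLike.ext_iff.mp (Wd.selmerGroup_eq_selmerGroup_kummerSelmerStructure _) _).mp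
      (kummerMapTorsion_mem_selmerGroup Wd _ (hdiv_two Wd) _)
  have hloc := twin_selmer_localization_ne_zero_of_selmerTrivial W hΔneg h2 hodd hH v₀ hC hsil h1 hκS hκ
  exact geomReduction_twist_ne_zero_of_localization_ne_zero F hF hℓ2 hΔ hv₀' z hloc

/-- **CLAIM B ON THE CURVE, at any prime `ℓ ∣ d_K` with silence off `ℓ` for the pair `(W, W^{(d_K)})`.**  `W/ℚ` globally minimal
elliptic with `Δ_W < 0`, `K` imaginary quadratic with odd `d_K`, Heegner for `N_W`, `#Sel₂(W) = 1`, `ℓ ∣ d_K` odd with `ℓ ∤ Δ_min(W)`,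
`v₀ ∋ ℓ`, every other prime of `d_K` silent for `W` and `W^{(d_K)}`; `τ ≠ 1` in `Aut(K/ℚ)`, `Y ∈ E(K)` with `τY = −Y` whose image
`e_*Y ∈ E(ℚ̄)` has NO half fixed by `res(Γ_K)`.  THEN **`red_𝔓(e_*Y) ≠ Õ`** (`e_*Y = F z̃` for a twin point `z ∈ W^{(d_K)}(ℚ)` with
`κ(z) ≠ 0`, then the twisted form). [cite: MazurRubin2010, Prop. 3.3, Cor. 3.4 (i)] [cite: SilvermanAEC2009, X.5 Cor. 5.4, VIII §1–§2] -/
theorem geomReduction_map_absEmbedding_ne_zero_of_anti_of_noHalf_of_silent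
    (hΔneg : W.Δ < 0) (hK : IsImaginaryQuadratic K) (hodd : Odd (discr K))
    (hH : SatisfiesHeegnerHypothesis (W.conductorNorm ℤ) K) {ℓ : ℕ} [Fact ℓ.Prime] (hℓ2 : ℓ ≠ 2)
    {v₀ : HeightOneSpectrum (𝓞 ℚ)} (hv₀ : (ℓ : 𝓞 ℚ) ∈ v₀.asIdeal)
    (hsil : ∀ v : HeightOneSpectrum (𝓞 ℚ), v ≠ v₀ → (((primesEquiv v : Nat.Primes) : ℕ) : ℤ) ∣ discr K →
      Nat.card (nsmulAddMonoidHom 2 : (W.baseChange (v.adicCompletion ℚ)).toAffine.Point →+ _).ker = 1 ∧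
      Nat.card (nsmulAddMonoidHom 2 :
        ((W.quadraticTwist (discr K : ℚ)).baseChange (v.adicCompletion ℚ)).toAffine.Point →+ _).ker = 1)
    (h1 : Nat.card (W.selmerGroup 2) = 1) {τ : K ≃ₐ[ℚ] K} (hτ : τ ≠ 1)
    {Y : (W.baseChange K).toAffine.Point} (hanti : τ • Y = -Y)
    (hY2 : ∀ H : W.geomPoints, (2 : ℤ) • H = Affine.Point.map (W' := W) (absEmbedding ℚ K) Y →
      ∃ σ : absoluteGaloisGroup ℚ, (haveI : Algebra.IsQuadraticExtension ℚ K := ⟨hK.1⟩; absGaloisQuot ℚ K σ = 1) ∧ σ • H ≠ H)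
    (hΔ : ¬ (ℓ : ℤ) ∣ minimalDiscriminantInt W) :
    geomReduction hΔ (Affine.Point.map (W' := W) (absEmbedding ℚ K) Y : W.geomPoints) ≠ 0 := by
  have hd0 : (discr K : ℚ) ≠ 0 := by exact_mod_cast (IsImaginaryQuadratic.discr_neg hK).ne
  haveI : (W.quadraticTwist (discr K : ℚ)).IsElliptic := W.isElliptic_quadraticTwist hd0
  obtain ⟨F, hF⟩ := exists_twistIso_sign_absGaloisQuot W hK
  obtain ⟨z, hz⟩ := exists_twin_point_of_anti W hK hτ F hF hanti
  have hκ := kummer_ne_zero_of_no_rational_half W hK F hF hz hY2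
  have hF' : ∀ σ : absoluteGaloisGroup ℚ, (∀ P, F (σ • P) = σ • F P) ∨ (∀ P, F (σ • P) = -(σ • F P)) := fun σ ↦
    (hF σ).imp (fun h ↦ h.2) (fun h ↦ h.2)
  have hC : (1 : VariableChange ℚ) • W.quadraticTwist (discr K : ℚ) = W.quadraticTwist (discr K : ℚ) := one_smul _ _
  rw [← hz]
  exact geomReduction_twist_ne_zero_of_kummer_ne_zero_of_selmerTrivial_of_silent W hΔneg hK.1 hodd hH hℓ2 hv₀ hC hsil F hF'
    h1 z hκ hΔ

/-- **CLAIM B ON THE CURVE, `K`-RATIONAL FORM, at any prime `ℓ ∣ d_K` with silence off `ℓ`.**  Same frame; `Y ∈ E(K)` anti-invariant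
with **`Y ∉ 2E(K)`** ⟹ **`red_𝔓(e_*Y) ≠ Õ`** at the place over `ℓ` (relative descent `E(ℚ̄)^{res Γ_K} = e_*E(K)`, g25's
`no_rational_half_of_not_exists_two_smul`).  For the cell: `Y = P₀ − s₀`, `P₀ ↦ y_K` (Gross 5.3), `Y ∉ 2E(K) ⟸ M₀ = 0` (K₁).
[cite: MazurRubin2010, Prop. 3.3, Cor. 3.4 (i)] [cite: SilvermanAEC2009, VIII §1, X.5 Cor. 5.4] [cite: GrossLMS1991, §5 Prop. 5.3] -/
theorem geomReduction_map_absEmbedding_ne_zero_of_anti_of_not_two_dvd_of_silent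
    (hΔneg : W.Δ < 0) (hK : IsImaginaryQuadratic K) (hodd : Odd (discr K))
    (hH : SatisfiesHeegnerHypothesis (W.conductorNorm ℤ) K) {ℓ : ℕ} [Fact ℓ.Prime] (hℓ2 : ℓ ≠ 2)
    {v₀ : HeightOneSpectrum (𝓞 ℚ)} (hv₀ : (ℓ : 𝓞 ℚ) ∈ v₀.asIdeal)
    (hsil : ∀ v : HeightOneSpectrum (𝓞 ℚ), v ≠ v₀ → (((primesEquiv v : Nat.Primes) : ℕ) : ℤ) ∣ discr K →
      Nat.card (nsmulAddMonoidHom 2 : (W.baseChange (v.adicCompletion ℚ)).toAffine.Point →+ _).ker = 1 ∧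
      Nat.card (nsmulAddMonoidHom 2 :
        ((W.quadraticTwist (discr K : ℚ)).baseChange (v.adicCompletion ℚ)).toAffine.Point →+ _).ker = 1)
    (h1 : Nat.card (W.selmerGroup 2) = 1) {τ : K ≃ₐ[ℚ] K} (hτ : τ ≠ 1)
    {Y : (W.baseChange K).toAffine.Point} (hanti : τ • Y = -Y)
    (hY : ¬ ∃ Q : (W.baseChange K).toAffine.Point, (2 : ℤ) • Q = Y)
    (hΔ : ¬ (ℓ : ℤ) ∣ minimalDiscriminantInt W) :
    geomReduction hΔ (Affine.Point.map (W' := W) (absEmbedding ℚ K) Y : W.geomPoints) ≠ 0 := by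
  haveI : Algebra.IsQuadraticExtension ℚ K := ⟨hK.1⟩
  haveI : IsGalois ℚ K := inferInstance
  exact geomReduction_map_absEmbedding_ne_zero_of_anti_of_noHalf_of_silent W hΔneg hK hodd hH hℓ2 hv₀ hsil h1 hτ hanti
    (no_rational_half_of_not_exists_two_smul W hY) hΔ

end ClaimB

end Summit.BirchSwinnertonDyer.BirchSwinnertonDyer.Theorems.GenusSupplyNarrow.DepthZero

end
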